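import Literature.NumberTheory.PAdicHodge.AinfDivisionTowerNilpotence
import Literature.NumberTheory.PAdicHodge.AinfEvalPtTruncationNil
import Literature.NumberTheory.PAdicHodge.BmaxPlusTheta
import Literature.NumberTheory.PAdicHodge.WittFrobeniusCongruence
import Literature.RingTheory.FormalGroups.PadicLogTypeSeriesDivision
import Literature.RingTheory.FormalGroups.PadicLogTypeSeriesNsmul
import Literature.RingTheory.FormalGroups.PadicLogTypeSeriesDeterminant
import HarnessLib

/-!
# The `[p]`-division tower of Fontaine's canonical lifts in `A_max`: `[p]`-compatibility of the periods `Λ_W([ũ])` and the EXACT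
# Dieudonné–Honda relation `φ²Λ − a·φΛ + p·Λ = 0`

Topic `Literature/NumberTheory/PAdicHodge`; namespace `Literature.NumberTheory.PAdicHodge.AinfTop`. THEOREMS ONLY (no definition, no named
fact, no instance, no `sorry`). The INSTANTIATION of the generic tower theorems
`Literature.RingTheory.FormalGroups.PadicLogSeries.logSum_eq_nsmul_of_tower` / `frobenius_honda_eq_zero_of_tower` /
`frob_det_eq_mul_det` at

  `B = B⁰_max = 𝔸_inf[ξ/p]` (`bmaxZero F p`), `B^_(p) = A_max = BmaxPlus F p`, `ι = (𝔸_inf → B⁰_max) ∘ zpToAinf`, `φ = frobBmaxZero`,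
  numerators `b = formalLogNum W p` of `log_W` (an integral Weierstrass equation `W/ℤ`), and the TOWER
  `x n = ι[ũ⁽ⁿ⁾]`, `[ũ⁽ⁿ⁾] = divisionLiftPt W hθ (u (n + ·))` — Fontaine's canonical lifts of the shifts of a `[p]_W`-division sequence
  `u = (uₙ)` of points of `Ŵ(𝔪_{ℂ_F})` (`[p]_W u_{n+1} = uₙ`, `u₀` arbitrary).

* §1 `divisionLiftPt_shift_eq_nsmul` — **`[ũ⁽ⁿ⁾] = p • [ũ⁽ⁿ⁺¹⁾]`** in the group `Ŵ(𝔫)` (`divisionLiftPt_val_nsmul_pt` of the shifted sequence);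
* §2 `algebraMap_mem_span_pow_of_mem_pow` (`(p, ξ)ʲ ↦ pʲB⁰_max`), ★ `logSum_nsmul_divisionLiftPt` — along the iterates `k • [ũ]` of a DEEP point
  (`‖u₀‖^N ≤ ‖p‖`): **`Λ_N(ι(k • [ũ])) = k · Λ_N(ι[ũ])`** in `A_max` (`logSum_eq_nsmul_of_tower` with `hszs` from `pow_coe_val_nsmul_divisionLiftPt_mem`,
  `hstep` from `coe_addW_sub_aeval_truncTotal_mem_pow_div`, `hbf = algebraMap_formalLogNum_eq`, `hfG = formalLog_subst_map_formalGroupLaw`);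
* §3 ★★ `logSum_divisionLiftPt_eq_natCast_mul_logSum_shift` — the **`[p]`-COMPATIBILITY `Λ_N(ι[ũ⁽ⁿ⁾]) = p · Λ_N(ι[ũ⁽ⁿ⁺¹⁾])`**;
* §4 ★★★★ `frobBmaxPlus_honda_logSum_divisionLiftPt_eq_zero` — for `ℓ_b` of Honda type `p − aT + T²` (`m ∣ B_m`, hypothesis `he`; for `W ⊗ ℤ_p` with good
  reduction and `a = a_p` this is `EllipticCurves.exists_natCast_mul_eq_honda_numerator`): **`φ²Λ − ι(a)·φΛ + p·Λ = 0` EXACTLY in `A_max`** for the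
  period `Λ = Λ_N(ι[ũ], z)` of EVERY `[p]`-division sequence `u` (the indices `N n` of the tower are running maxima of the per-level nilpotence
  indices `‖uₙ‖^{Nₙ} ≤ ‖p‖`; Frobenius lifts from `exists_frobenius_eq_pow_add`); `exists_pow_eq_natCast_mul_divisionLiftPt` (a witness `ι[ũ]^N = p·z`
  always exists);
* §5 ★★ `frobBmaxPlus_det_logSum_divisionLiftPt` — **`φD = p·D`** for the Legendre determinant `D = Λ·φΛ′ − φΛ·Λ′` of two division sequences.

This is brick (M) («tower instantiation») of the φ-road of line `kato_lever` (crux K★ `stmt-BirchSwinnertonDyer-22226`, memo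
`Summits/…/Cruxes/StarredOptimalManinUnitFiveSeven/Lines/kato-lever-K2-phi-road.md` §6): the periods `(L_x, M_x := φL_x)` of all universal-cover
elements of `Ŵ` satisfy `φ(L, M) = (L, M)·[[0, −p], [1, a]]` on the nose. Infrastructure only; BSD / K★ are not proved by any of this.

## References
* T. Honda, *On the theory of commutative formal groups*, J. Math. Soc. Japan 22 (1970), Thm. 2 (p. 223), §6.2. [Honda1970]
* P. Colmez, *Périodes p-adiques des variétés abéliennes*, Math. Ann. 292 (1992), §2. [Colmez1992PeriodesAbeliennes]
* J.-M. Fontaine, *Le corps des périodes p-adiques*, Astérisque 223 (1994), Exp. II §1.2.2, §1.3. [FontaineAsterisque223III]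
* J. H. Silverman, *The Arithmetic of Elliptic Curves* (2009), IV.2.3, IV.5.2. [SilvermanAEC2009]
-/

noncomputable section

open Ideal WittVector MvPowerSeries ValuativeRel Field

namespace Literature.NumberTheory.PAdicHodge

namespace AinfTop

open Literature.NumberTheory.GaloisRepresentations Literature.NumberTheory.GaloisRepresentations.IsNonarchimedeanLocalField
open Literature.NumberTheory.GaloisRepresentations.LubinTate Literature.NumberTheory.EllipticCurves
open Literature.RingTheory.FormalGroups Literature.AlgebraicGeometry.Resolution
open MvPowerSeries (truncTotal)

variable {F : Type} [Field F] [ValuativeRel F] [TopologicalSpace F] [IsNonarchimedeanLocalField F]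
  [CharZero F] {p : ℕ} [Fact p.Prime] [Fact (¬ IsUnit (p : integerC F))]
  [IsAdicComplete (Ideal.span {(p : integerC F)}) (integerC F)]
  {hθ : Function.Surjective (fontaineTheta (integerC F) p)} (W : WeierstrassCurve ℤ)

/-! ## §1 The tower of canonical lifts: `[ũ⁽ⁿ⁾] = p • [ũ⁽ⁿ⁺¹⁾]` -/

/-- **`[ũ⁽ⁿ⁾] = p • [ũ⁽ⁿ⁺¹⁾]` in `Ŵ(𝔫)`**: Fontaine's integral of the `n`-th shift of a `[p]`-division sequence is `p` times the integral of the
`(n+1)`-st shift (`[p]_W` applied termwise to `u⁽ⁿ⁺¹⁾` is `u⁽ⁿ⁾`, and integration is `ℕ`-linear, `divisionLiftPt_val_nsmul_pt`).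
[cite: FontaineAsterisque223III, Exp. II §1.2.2] [cite: SilvermanAEC2009, IV.2.3] -/
theorem divisionLiftPt_shift_eq_nsmul {u : ℕ → (maxNilIdealC F).toIdeal} (hup : ∀ n, mulPC F p W (u (n + 1)) = u n) (n : ℕ) :
    divisionLiftPt W hθ (fun i => u (n + i)) (mulPC_shift W hup n) =
      p • divisionLiftPt W hθ (fun i => u (n + 1 + i)) (mulPC_shift W hup (n + 1)) := by
  have hseq : (fun i => ((p • (⟨u (n + 1 + i)⟩ : W.Pt (maxNilIdealC F))).val)) = fun i => u (n + i) := by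
    funext i
    rw [← GaloisContinuity.mulPC_eq_val_nsmul (p := p), show n + 1 + i = n + i + 1 by omega]
    exact hup (n + i)
  rw [← GaloisContinuity.divisionLiftPt_val_nsmul_pt W (u := fun i => u (n + 1 + i)) (mulPC_shift W hup (n + 1)) p]
  exact divisionLiftPt_congr W hseq.symm _ _

/-! ## §2 Along the iterates `k • [ũ]` of a deep point: `Λ_N(ι(k • [ũ])) = k · Λ_N(ι[ũ])` in `A_max` -/

omit [CharZero F] [IsAdicComplete (Ideal.span {(p : integerC F)}) (integerC F)] in
/-- **`(p, ξ)ʲ𝔸_inf ↦ pʲ·B⁰_max`** under `𝔸_inf → B⁰_max = 𝔸_inf[ξ/p]` (`ξ = p·(ξ/p)`, `BmaxPlusTheta.algebraMap_mem_span_of_mem_span_p_xi`), for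
elements of the topological copy `AinfTop F p`. [cite: FontaineAsterisque223III, Exp. II §1.3] -/
theorem algebraMap_mem_span_pow_of_mem_pow {j : ℕ} {a : AinfTop F p} (ha : a ∈ (WithIdeal.i : Ideal (AinfTop F p)) ^ j) :
    algebraMap (Ainf (p := p) F) (bmaxZero F p) ((AinfTop.of F p).symm a) ∈ Ideal.span {(p : bmaxZero F p)} ^ j := by
  have hmap : (Ideal.span {(p : Ainf (p := p) F), xi}).map (algebraMap (Ainf (p := p) F) (bmaxZero F p)) ≤
      Ideal.span {(p : bmaxZero F p)} :=
    Ideal.map_le_iff_le_comap.2 fun b hb => algebraMap_mem_span_of_mem_span_p_xi hb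
  have ha' : (AinfTop.of F p).symm a ∈ (Ideal.span {(p : Ainf (p := p) F), xi}) ^ j := ha
  have h := Ideal.mem_map_of_mem (algebraMap (Ainf (p := p) F) (bmaxZero F p)) ha'
  rw [Ideal.map_pow] at h
  exact Ideal.pow_right_mono hmap j h

set_option maxHeartbeats 1600000 in
/-- ★ **`Λ_N(ι(k • [ũ])) = k · Λ_N(ι[ũ])` in `A_max`** along the iterates of a DEEP point. Let `u` be a `[p]`-division sequence of points of
`Ŵ(𝔪_{ℂ_F})` with `‖u₀‖^N ≤ ‖p‖` (`N ≥ 1`), `[ũ] = divisionLiftPt W hθ u ∈ Ŵ(𝔫)` Fontaine's integral, `ι : 𝔸_inf → B⁰_max`. Every iterate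
`k • [ũ]` is `(p, ξ)`-nilpotent of index `N` (`pow_coe_val_nsmul_divisionLiftPt_mem`), so `ι((k • [ũ]))^N = p·z_k` in `B⁰_max`; for ANY such witnesses,
the `p`-adic sums `Λ_N = p^N·log_W` (`PadicLogSeries.logSum`, numerators `formalLogNum W p`) satisfy **`Λ_N(ι(k • [ũ]), z_k) = k · Λ_N(ι[ũ], z₁)`** —
`PadicLogSeries.logSum_eq_nsmul_of_tower` with the chord–tangent truncation estimate `coe_addW_sub_aeval_truncTotal_mem_pow_div` transported to
`B⁰_max` (`(p, ξ) ↦ (p)`). [cite: Colmez1992PeriodesAbeliennes, §2] [cite: SilvermanAEC2009, IV.5.2] -/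
theorem logSum_nsmul_divisionLiftPt {u : ℕ → (maxNilIdealC F).toIdeal} (hup : ∀ n, mulPC F p W (u (n + 1)) = u n) {N : ℕ} (hN : 1 ≤ N)
    (huN : ‖(((u 0 : (maxNilIdealC F).toIdeal) : CBall F) : CompletedAlgClosure F)‖ ^ N ≤ ‖(p : CompletedAlgClosure F)‖) (k : ℕ)
    {zk z₁ : bmaxZero F p}
    (hzk : algebraMap (Ainf (p := p) F) (bmaxZero F p)
        ((AinfTop.of F p).symm (((k • divisionLiftPt W hθ u hup).val : (nilTheta F p hθ).toIdeal) : AinfTop F p)) ^ N =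
      (p : bmaxZero F p) * zk)
    (hz₁ : algebraMap (Ainf (p := p) F) (bmaxZero F p)
        ((AinfTop.of F p).symm (((divisionLiftPt W hθ u hup).val : (nilTheta F p hθ).toIdeal) : AinfTop F p)) ^ N =
      (p : bmaxZero F p) * z₁) :
    PadicLogSeries.logSum ((algebraMap (Ainf (p := p) F) (bmaxZero F p)).comp zpToAinf) (GaloisContinuity.formalLogNum W p) N
        (algebraMap (Ainf (p := p) F) (bmaxZero F p)
          ((AinfTop.of F p).symm (((k • divisionLiftPt W hθ u hup).val : (nilTheta F p hθ).toIdeal) : AinfTop F p))) zk =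
      (k : BmaxPlus F p) *
        PadicLogSeries.logSum ((algebraMap (Ainf (p := p) F) (bmaxZero F p)).comp zpToAinf) (GaloisContinuity.formalLogNum W p) N
          (algebraMap (Ainf (p := p) F) (bmaxZero F p)
            ((AinfTop.of F p).symm (((divisionLiftPt W hθ u hup).val : (nilTheta F p hθ).toIdeal) : AinfTop F p))) z₁ := by
  haveI := isDomain_bmaxZero (F := F) (p := p)
  haveI := charZero_bmaxZero (F := F) (p := p)
  set Q := divisionLiftPt W hθ u hup with hQ
  let gT : AinfTop F p →+* bmaxZero F p := (algebraMap (Ainf (p := p) F) (bmaxZero F p)).comp (AinfTop.of F p).symm.toRingHom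
  have hgT : ∀ a : AinfTop F p, gT a = algebraMap (Ainf (p := p) F) (bmaxZero F p) ((AinfTop.of F p).symm a) := fun a => rfl
  -- every iterate is `(p, ξ)`-nilpotent of index `N`, hence `p`-nilpotent in `B⁰_max`
  have hnil : ∀ j : ℕ, (((j • Q).val : (nilTheta F p hθ).toIdeal) : AinfTop F p) ^ N ∈ (WithIdeal.i : Ideal (AinfTop F p)) :=
    fun j => pow_coe_val_nsmul_divisionLiftPt_mem W hup huN j
  have hnil1 : ((Q.val : (nilTheta F p hθ).toIdeal) : AinfTop F p) ^ N ∈ (WithIdeal.i : Ideal (AinfTop F p)) := by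
    simpa only [one_nsmul] using hnil 1
  have hw : ∀ j : ℕ, ∃ zj : bmaxZero F p, gT (((j • Q).val : (nilTheta F p hθ).toIdeal) : AinfTop F p) ^ N = (p : bmaxZero F p) * zj :=
    fun j => exists_algebraMap_pow_eq_natCast_mul (hnil j)
  choose zs hzs using hw
  -- the truncation estimate, transported to `B⁰_max`
  -- (the generic tower lemma reads `B⁰_max` as a `ℤ`-algebra through `Ring.toIntAlgebra`, not through the subalgebra instance)
  have hstep : ∀ j m : ℕ, ∃ D₀ : ℕ, ∀ D, D₀ ≤ D →
      gT ((((j + 1) • Q).val : (nilTheta F p hθ).toIdeal) : AinfTop F p) -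
        @MvPolynomial.aeval ℤ (bmaxZero F p) (Fin 2) _ _ (Ring.toIntAlgebra _)
          (![gT (((j • Q).val : (nilTheta F p hθ).toIdeal) : AinfTop F p),
            algebraMap (Ainf (p := p) F) (bmaxZero F p) ((AinfTop.of F p).symm ((Q.val : (nilTheta F p hθ).toIdeal) : AinfTop F p))] :
              Fin 2 → bmaxZero F p)
          (truncTotal (D + 1) W.formalGroupLaw) ∈ Ideal.span {(p : bmaxZero F p)} ^ m := by
    intro j m
    refine ⟨(N + N) * m, fun D hD => ?_⟩
    have h1 := coe_addW_sub_aeval_truncTotal_mem_pow_div (hθ := hθ) W (j • Q).val Q.val (hnil j) hnil1 D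
    have hle : m ≤ (D + 1) / (N + N) := (Nat.le_div_iff_mul_le (by omega)).2 (by nlinarith)
    have h2 := algebraMap_mem_span_pow_of_mem_pow (F := F) (p := p) (Ideal.pow_le_pow_right hle h1)
    have hfun : (fun i => gT (((![(j • Q).val, Q.val] : Fin 2 → (nilTheta F p hθ).toIdeal) i : (nilTheta F p hθ).toIdeal) : AinfTop F p)) =
        (![gT (((j • Q).val : (nilTheta F p hθ).toIdeal) : AinfTop F p),
          algebraMap (Ainf (p := p) F) (bmaxZero F p) ((AinfTop.of F p).symm ((Q.val : (nilTheta F p hθ).toIdeal) : AinfTop F p))] :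
          Fin 2 → bmaxZero F p) := by
      funext i; fin_cases i <;> rfl
    have e : algebraMap (Ainf (p := p) F) (bmaxZero F p) ((AinfTop.of F p).symm
        (((addW W (j • Q).val Q.val : (nilTheta F p hθ).toIdeal) : AinfTop F p) -
          MvPolynomial.aeval (fun i => (((![(j • Q).val, Q.val] : Fin 2 → (nilTheta F p hθ).toIdeal) i : (nilTheta F p hθ).toIdeal) :
            AinfTop F p)) (truncTotal (D + 1) W.formalGroupLaw))) =
        gT ((((j + 1) • Q).val : (nilTheta F p hθ).toIdeal) : AinfTop F p) -
          @MvPolynomial.aeval ℤ (bmaxZero F p) (Fin 2) _ _ (Ring.toIntAlgebra _)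
            (![gT (((j • Q).val : (nilTheta F p hθ).toIdeal) : AinfTop F p),
              algebraMap (Ainf (p := p) F) (bmaxZero F p) ((AinfTop.of F p).symm ((Q.val : (nilTheta F p hθ).toIdeal) : AinfTop F p))] :
                Fin 2 → bmaxZero F p)
            (truncTotal (D + 1) W.formalGroupLaw) := by
      show gT (_ - _) = _
      rw [map_sub, succ_nsmul, val_add_N]
      congr 1
      rw [MvPolynomial.map_aeval, ← hfun]
      exact MvPolynomial.eval₂Hom_congr (f₂ := @algebraMap ℤ (bmaxZero F p) _ _ (Ring.toIntAlgebra _)) (RingHom.ext_int _ _) rfl rfl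
    rw [e] at h2
    exact h2
  have hs0 : gT (((0 • Q).val : (nilTheta F p hθ).toIdeal) : AinfTop F p) = 0 := by
    rw [zero_nsmul, WeierstrassCurve.Pt.val_zero, ZeroMemClass.coe_zero, map_zero]
  have htower := PadicLogSeries.logSum_eq_nsmul_of_tower ((algebraMap (Ainf (p := p) F) (bmaxZero F p)).comp zpToAinf)
    (GaloisContinuity.formalLogNum W p) (W.map (Int.castRingHom ℚ)).formalLog
    (algebraMap_formalLogNum_eq W ((algebraMap (Ainf (p := p) F) (bmaxZero F p)).comp zpToAinf))
    W.constantCoeff_formalGroupLaw (GaloisContinuity.formalLog_subst_map_formalGroupLaw W) hN hz₁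
    (fun j => gT (((j • Q).val : (nilTheta F p hθ).toIdeal) : AinfTop F p)) zs hs0 hzs hstep k
  exact (PadicLogSeries.logSum_congr_witness _ _ hzk (hzs k)).trans htower

/-! ## §3 The `[p]`-compatibility `Λ_N(ι[ũ⁽ⁿ⁾]) = p · Λ_N(ι[ũ⁽ⁿ⁺¹⁾])` -/

set_option maxHeartbeats 1600000 in
/-- ★★ **`Λ_N(ι[ũ⁽ⁿ⁾]) = p · Λ_N(ι[ũ⁽ⁿ⁺¹⁾])` in `A_max`**: for a `[p]`-division sequence `u` in `Ŵ(𝔪_{ℂ_F})` whose `(n+1)`-st member is deep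
(`‖u_{n+1}‖^N ≤ ‖p‖`, `N ≥ 1`) and any witnesses `ι[ũ⁽ⁿ⁾]^N = p·z`, `ι[ũ⁽ⁿ⁺¹⁾]^N = p·z′` in `B⁰_max`, the periods of the canonical lifts of the
shifts `u⁽ⁿ⁾ = u(n + ·)` satisfy the `[p]`-COMPATIBILITY consumed by `PadicLogSeries.frobenius_honda_eq_zero_of_tower` (`[ũ⁽ⁿ⁾] = p • [ũ⁽ⁿ⁺¹⁾]`,
`divisionLiftPt_shift_eq_nsmul`, and `logSum_nsmul_divisionLiftPt`). [cite: Colmez1992PeriodesAbeliennes, §2] [cite: SilvermanAEC2009, IV.2.3, IV.5.2] -/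
theorem logSum_divisionLiftPt_eq_natCast_mul_logSum_shift {u : ℕ → (maxNilIdealC F).toIdeal} (hup : ∀ n, mulPC F p W (u (n + 1)) = u n)
    (n : ℕ) {N : ℕ} (hN : 1 ≤ N)
    (huN : ‖(((u (n + 1) : (maxNilIdealC F).toIdeal) : CBall F) : CompletedAlgClosure F)‖ ^ N ≤ ‖(p : CompletedAlgClosure F)‖)
    {z z' : bmaxZero F p}
    (hz : algebraMap (Ainf (p := p) F) (bmaxZero F p) ((AinfTop.of F p).symm
        (((divisionLiftPt W hθ (fun i => u (n + i)) (mulPC_shift W hup n)).val : (nilTheta F p hθ).toIdeal) : AinfTop F p)) ^ N =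
      (p : bmaxZero F p) * z)
    (hz' : algebraMap (Ainf (p := p) F) (bmaxZero F p) ((AinfTop.of F p).symm
        (((divisionLiftPt W hθ (fun i => u (n + 1 + i)) (mulPC_shift W hup (n + 1))).val : (nilTheta F p hθ).toIdeal) : AinfTop F p)) ^ N =
      (p : bmaxZero F p) * z') :
    PadicLogSeries.logSum ((algebraMap (Ainf (p := p) F) (bmaxZero F p)).comp zpToAinf) (GaloisContinuity.formalLogNum W p) N
        (algebraMap (Ainf (p := p) F) (bmaxZero F p) ((AinfTop.of F p).symm
          (((divisionLiftPt W hθ (fun i => u (n + i)) (mulPC_shift W hup n)).val : (nilTheta F p hθ).toIdeal) : AinfTop F p))) z =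
      (p : BmaxPlus F p) *
        PadicLogSeries.logSum ((algebraMap (Ainf (p := p) F) (bmaxZero F p)).comp zpToAinf) (GaloisContinuity.formalLogNum W p) N
          (algebraMap (Ainf (p := p) F) (bmaxZero F p) ((AinfTop.of F p).symm
            (((divisionLiftPt W hθ (fun i => u (n + 1 + i)) (mulPC_shift W hup (n + 1))).val : (nilTheta F p hθ).toIdeal) :
              AinfTop F p))) z' := by
  have hshift := divisionLiftPt_shift_eq_nsmul W (hθ := hθ) hup n
  rw [hshift] at hz ⊢
  exact logSum_nsmul_divisionLiftPt W (u := fun i => u (n + 1 + i)) (mulPC_shift W hup (n + 1)) hN (by simpa using huN) p hz hz'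

/-! ## §4 The exact Dieudonné–Honda relation `φ²Λ − ι(a)·φΛ + p·Λ = 0` for the period of every `[p]`-division sequence -/

/-- **A witness `ι[ũ]^N = p·z` in `B⁰_max` always exists** (`N ≥ 1`): the base point `u₀ ∈ 𝔪_{ℂ_F}` of a `[p]`-division sequence has `‖u₀‖ < 1`,
so `‖u₀‖^N ≤ ‖p‖` for some `N ≥ 1`, and then `[ũ]^N ∈ (p, ξ) ↦ p·B⁰_max` (`pow_coe_val_nsmul_divisionLiftPt_mem`,
`exists_algebraMap_pow_eq_natCast_mul`). [cite: FontaineAsterisque223III, Exp. II §1.3] [cite: Colmez1992PeriodesAbeliennes, §2] -/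
theorem exists_pow_eq_natCast_mul_divisionLiftPt {u : ℕ → (maxNilIdealC F).toIdeal} (hup : ∀ n, mulPC F p W (u (n + 1)) = u n) :
    ∃ (N : ℕ) (z : bmaxZero F p), 1 ≤ N ∧
      ‖(((u 0 : (maxNilIdealC F).toIdeal) : CBall F) : CompletedAlgClosure F)‖ ^ N ≤ ‖(p : CompletedAlgClosure F)‖ ∧
      algebraMap (Ainf (p := p) F) (bmaxZero F p)
          ((AinfTop.of F p).symm (((divisionLiftPt W hθ u hup).val : (nilTheta F p hθ).toIdeal) : AinfTop F p)) ^ N =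
        (p : bmaxZero F p) * z := by
  have hlt : ‖(((u 0 : (maxNilIdealC F).toIdeal) : CBall F) : CompletedAlgClosure F)‖ < 1 := (u 0).2
  obtain ⟨M, hM⟩ := exists_pow_lt_of_lt_one (norm_pos_iff.2 (natCast_C_ne_zero (F := F) (Fact.out : p.Prime).ne_zero)) hlt
  have hM1 : ‖(((u 0 : (maxNilIdealC F).toIdeal) : CBall F) : CompletedAlgClosure F)‖ ^ (M + 1) ≤ ‖(p : CompletedAlgClosure F)‖ :=
    (pow_le_pow_of_le_one (norm_nonneg _) hlt.le (Nat.le_succ M)).trans hM.le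
  have hmem := pow_coe_val_nsmul_divisionLiftPt_mem W (hθ := hθ) hup hM1 1
  rw [one_nsmul] at hmem
  obtain ⟨z, hz⟩ := exists_algebraMap_pow_eq_natCast_mul (F := F) (p := p) hmem
  exact ⟨M + 1, z, Nat.succ_pos M, hM1, hz⟩

set_option maxHeartbeats 3200000 in
/-- ★★★★ **The exact Dieudonné–Honda relation in `A_max` for the period of a universal-cover element.** Let `W/ℤ` be an integral Weierstrass
equation whose formal logarithm `log_W = Σ (b_m/m)Xᵐ` (`b = formalLogNum W p`) is of Honda type `p − aT + T²` — i.e. `m ∣ B_m := b_m − [p∣m]·a·b_{m/p}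
+ [p²∣m]·p·b_{m/p²}` in `ℤ_p` (hypothesis `he`; for `W ⊗ ℤ_p` with elliptic generic and special fibre and `a = a_p` this is
`EllipticCurves.exists_natCast_mul_eq_honda_numerator`). Let `u = (uₙ)` be ANY `[p]_W`-division sequence of points of `Ŵ(𝔪_{ℂ_F})` (`u₀` arbitrary),
`[ũ] ∈ Ŵ(𝔫)` Fontaine's integral, and `Λ = Λ_N(ι[ũ], z) = p^N·log_W(ι[ũ]) ∈ A_max = B_max⁺(F)` its period (`PadicLogSeries.logSum`, any witness
`ι[ũ]^N = p·z`, `exists_pow_eq_natCast_mul_divisionLiftPt`). Then, with `φ = frobBmaxPlus`: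

  **`φ²Λ − ι(a)·φΛ + p·Λ = 0`** EXACTLY.

Proof: the tower `x n = ι[ũ⁽ⁿ⁾]` of canonical lifts of the shifts `u⁽ⁿ⁾ = u(n + ·)`, with indices the running maxima of the per-level nilpotence indices
(`‖uₙ‖^{Mₙ} ≤ ‖p‖`), Frobenius lifts `φ(x n) = (x n)ᵖ + p·h n` (`exists_frobenius_eq_pow_add`) and the `[p]`-compatibility
`logSum_divisionLiftPt_eq_natCast_mul_logSum_shift`, fed to `PadicLogSeries.frobenius_honda_eq_zero_of_tower`. In the basis `(L, M := φL)` of periods this says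
`φ(L, M) = (L, M)·[[0, −p], [1, a]]`, brick (M) of the φ-road. [cite: Honda1970, Thm. 2 (p. 223) and §6.2] [cite: Colmez1992PeriodesAbeliennes, §2] -/
theorem frobBmaxPlus_honda_logSum_divisionLiftPt_eq_zero (a : ℤ_[p]) (e : ℕ → ℤ_[p])
    (he : ∀ m : ℕ, m ≠ 0 → (m : ℤ_[p]) * e m =
      GaloisContinuity.formalLogNum W p m - (if p ∣ m then a * GaloisContinuity.formalLogNum W p (m / p) else 0) +
        (if p ^ 2 ∣ m then (p : ℤ_[p]) * GaloisContinuity.formalLogNum W p (m / p ^ 2) else 0))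
    {u : ℕ → (maxNilIdealC F).toIdeal} (hup : ∀ n, mulPC F p W (u (n + 1)) = u n) {N : ℕ} (hN : 1 ≤ N) {z : bmaxZero F p}
    (hz : algebraMap (Ainf (p := p) F) (bmaxZero F p)
        ((AinfTop.of F p).symm (((divisionLiftPt W hθ u hup).val : (nilTheta F p hθ).toIdeal) : AinfTop F p)) ^ N =
      (p : bmaxZero F p) * z) :
    frobBmaxPlus F p (frobBmaxPlus F p
        (PadicLogSeries.logSum ((algebraMap (Ainf (p := p) F) (bmaxZero F p)).comp zpToAinf) (GaloisContinuity.formalLogNum W p) N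
          (algebraMap (Ainf (p := p) F) (bmaxZero F p)
            ((AinfTop.of F p).symm (((divisionLiftPt W hθ u hup).val : (nilTheta F p hθ).toIdeal) : AinfTop F p))) z)) -
      AdicCompletion.of (Ideal.span {(p : bmaxZero F p)}) (bmaxZero F p)
          (((algebraMap (Ainf (p := p) F) (bmaxZero F p)).comp zpToAinf) a) *
        frobBmaxPlus F p
          (PadicLogSeries.logSum ((algebraMap (Ainf (p := p) F) (bmaxZero F p)).comp zpToAinf) (GaloisContinuity.formalLogNum W p) N
            (algebraMap (Ainf (p := p) F) (bmaxZero F p)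
              ((AinfTop.of F p).symm (((divisionLiftPt W hθ u hup).val : (nilTheta F p hθ).toIdeal) : AinfTop F p))) z) +
      AdicCompletion.of (Ideal.span {(p : bmaxZero F p)}) (bmaxZero F p) (p : bmaxZero F p) *
        PadicLogSeries.logSum ((algebraMap (Ainf (p := p) F) (bmaxZero F p)).comp zpToAinf) (GaloisContinuity.formalLogNum W p) N
          (algebraMap (Ainf (p := p) F) (bmaxZero F p)
            ((AinfTop.of F p).symm (((divisionLiftPt W hθ u hup).val : (nilTheta F p hθ).toIdeal) : AinfTop F p))) z = 0 := by
  haveI := isDomain_bmaxZero (F := F) (p := p)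
  haveI := charZero_bmaxZero (F := F) (p := p)
  -- the tower `x n = ι[ũ⁽ⁿ⁾]` (opaque, with its defining equations)
  obtain ⟨x, hx⟩ : ∃ x : ℕ → bmaxZero F p, ∀ n, x n = algebraMap (Ainf (p := p) F) (bmaxZero F p) ((AinfTop.of F p).symm
      (((divisionLiftPt W hθ (fun i => u (n + i)) (mulPC_shift W hup n)).val : (nilTheta F p hθ).toIdeal) : AinfTop F p)) :=
    ⟨_, fun n => rfl⟩
  have hQ0 : divisionLiftPt W hθ (fun i => u (0 + i)) (mulPC_shift W hup 0) = divisionLiftPt W hθ u hup :=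
    divisionLiftPt_congr W (funext fun i => by rw [Nat.zero_add]) _ _
  have hx0 : x 0 = algebraMap (Ainf (p := p) F) (bmaxZero F p)
      ((AinfTop.of F p).symm (((divisionLiftPt W hθ u hup).val : (nilTheta F p hθ).toIdeal) : AinfTop F p)) := by
    rw [hx, hQ0]
  -- per-level nilpotence indices `‖uₙ‖^{Mₙ} ≤ ‖p‖` and their running maxima `N'` (with `N' 0 = N`)
  have hM : ∀ n, ∃ M : ℕ, ‖(((u n : (maxNilIdealC F).toIdeal) : CBall F) : CompletedAlgClosure F)‖ ^ M ≤ ‖(p : CompletedAlgClosure F)‖ := by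
    intro n
    have hlt : ‖(((u n : (maxNilIdealC F).toIdeal) : CBall F) : CompletedAlgClosure F)‖ < 1 := (u n).2
    obtain ⟨M, hM⟩ := exists_pow_lt_of_lt_one (norm_pos_iff.2 (natCast_C_ne_zero (F := F) (Fact.out : p.Prime).ne_zero)) hlt
    exact ⟨M, hM.le⟩
  choose M hM using hM
  obtain ⟨N', hN'0, hN'mono, hN'M⟩ : ∃ N' : ℕ → ℕ, N' 0 = N ∧ Monotone N' ∧ ∀ n, M (n + 1) ≤ N' (n + 1) :=
    ⟨fun n => Nat.rec N (fun k Nk => max Nk (M (k + 1))) n, rfl, monotone_nat_of_le_succ fun n => le_max_left _ _,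
      fun n => le_max_right _ _⟩
  have hN'1 : ∀ n, 1 ≤ N' n := fun n => (hN.trans_eq hN'0.symm).trans (hN'mono (Nat.zero_le n))
  have hnorm : ∀ n, ‖(((u (n + 1) : (maxNilIdealC F).toIdeal) : CBall F) : CompletedAlgClosure F)‖ ^ N' (n + 1) ≤
      ‖(p : CompletedAlgClosure F)‖ := fun n => by
    have hlt : ‖(((u (n + 1) : (maxNilIdealC F).toIdeal) : CBall F) : CompletedAlgClosure F)‖ < 1 := (u (n + 1)).2
    exact (pow_le_pow_of_le_one (norm_nonneg _) hlt.le (hN'M n)).trans (hM (n + 1))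
  -- witnesses `(x n)^{N' n} = p · zf n`
  have hw : ∀ n, ∃ zn : bmaxZero F p, x n ^ N' n = (p : bmaxZero F p) * zn := by
    intro n
    cases n with
    | zero => exact ⟨z, by rw [hx0, hN'0]; exact hz⟩
    | succ n =>
      have hmem := pow_coe_val_nsmul_divisionLiftPt_mem W (hθ := hθ) (u := fun i => u (n + 1 + i)) (mulPC_shift W hup (n + 1)) (hnorm n) 1
      rw [one_nsmul] at hmem
      rw [hx]
      exact exists_algebraMap_pow_eq_natCast_mul hmem
  choose zf hzf using hw
  -- Frobenius lifts `φ(x n) = (x n)ᵖ + p · hf n`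
  have hφ : ∀ n, ∃ h : bmaxZero F p, frobBmaxZero F p (x n) = x n ^ p + (p : bmaxZero F p) * h := by
    intro n
    obtain ⟨h₀, hh₀⟩ := exists_frobenius_eq_pow_add ((AinfTop.of F p).symm
      (((divisionLiftPt W hθ (fun i => u (n + i)) (mulPC_shift W hup n)).val : (nilTheta F p hθ).toIdeal) : AinfTop F p))
    refine ⟨algebraMap (Ainf (p := p) F) (bmaxZero F p) h₀, ?_⟩
    rw [hx, frobBmaxZero_algebraMap, hh₀, map_add, map_pow, map_mul, map_natCast]
  choose hf hhf using hφ
  -- the `[p]`-compatibility along the tower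
  have hofp : AdicCompletion.of (Ideal.span {(p : bmaxZero F p)}) (bmaxZero F p) (p : bmaxZero F p) = (p : BmaxPlus F p) :=
    map_natCast (algebraMap (bmaxZero F p) (BmaxPlus F p)) p
  have hdiv : ∀ n, PadicLogSeries.logSum ((algebraMap (Ainf (p := p) F) (bmaxZero F p)).comp zpToAinf) (GaloisContinuity.formalLogNum W p)
        (N' (n + 1)) (x n) (zf n * x n ^ (N' (n + 1) - N' n)) =
      AdicCompletion.of (Ideal.span {(p : bmaxZero F p)}) (bmaxZero F p) (p : bmaxZero F p) *
        PadicLogSeries.logSum ((algebraMap (Ainf (p := p) F) (bmaxZero F p)).comp zpToAinf) (GaloisContinuity.formalLogNum W p)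
          (N' (n + 1)) (x (n + 1)) (zf (n + 1)) := by
    intro n
    have hxz' : x n ^ N' (n + 1) = (p : bmaxZero F p) * (zf n * x n ^ (N' (n + 1) - N' n)) := by
      rw [← mul_assoc, ← hzf n, ← pow_add, Nat.add_sub_cancel' (hN'mono (Nat.le_succ n))]
    have hz1 := hzf (n + 1)
    simp only [hx] at hxz' hz1 ⊢
    rw [logSum_divisionLiftPt_eq_natCast_mul_logSum_shift W hup n (hN'1 (n + 1)) (hnorm n) hxz' hz1, hofp]
  -- the generic exact relation on the tower
  have hR := PadicLogSeries.frobenius_honda_eq_zero_of_tower ((algebraMap (Ainf (p := p) F) (bmaxZero F p)).comp zpToAinf)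
    (GaloisContinuity.formalLogNum W p) (frobBmaxZero F p) frobBmaxZero_comp_algebraMap_comp_zpToAinf a e he x zf hf N'
    (by rw [hN'0]; exact hN) hN'mono hzf hhf hdiv
  -- read it at the bottom `x 0 = ι[ũ]`, index `N' 0 = N`, witness `z`
  have hz0 : algebraMap (Ainf (p := p) F) (bmaxZero F p)
      ((AinfTop.of F p).symm (((divisionLiftPt W hθ u hup).val : (nilTheta F p hθ).toIdeal) : AinfTop F p)) ^ N =
        (p : bmaxZero F p) * zf 0 := by
    rw [← hx0, ← hN'0]; exact hzf 0
  rw [hN'0, hx0, PadicLogSeries.logSum_congr_witness _ _ hz0 hz] at hR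
  exact hR

/-! ## §5 `φD = p·D` for the Legendre determinant of two division sequences -/

set_option maxHeartbeats 3200000 in
/-- ★★ **`φD = p·D` for the Legendre determinant** `D = Λ·φΛ′ − φΛ·Λ′` of the periods `Λ = Λ_N(ι[ũ], z)`, `Λ′ = Λ_{N′}(ι[ũ′], z′)` of two `[p]_W`-division
sequences `u`, `u′` (same `W`, same Honda type `p − aT + T²`): the companion matrix `[[0, −p], [1, a]]` has determinant `p`
(`PadicLogSeries.frob_det_eq_mul_det`). With `u′` a division sequence of an `F`-rational point and `u` running through `T_pŴ` this is the `φ`-eigenvector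
property of the Legendre resolution of the φ-road to (K₂). [cite: Honda1970, Thm. 2 (p. 223)] [cite: Colmez1992PeriodesAbeliennes, §2] -/
theorem frobBmaxPlus_det_logSum_divisionLiftPt (a : ℤ_[p]) (e : ℕ → ℤ_[p])
    (he : ∀ m : ℕ, m ≠ 0 → (m : ℤ_[p]) * e m =
      GaloisContinuity.formalLogNum W p m - (if p ∣ m then a * GaloisContinuity.formalLogNum W p (m / p) else 0) +
        (if p ^ 2 ∣ m then (p : ℤ_[p]) * GaloisContinuity.formalLogNum W p (m / p ^ 2) else 0))
    {u u' : ℕ → (maxNilIdealC F).toIdeal} (hup : ∀ n, mulPC F p W (u (n + 1)) = u n) (hup' : ∀ n, mulPC F p W (u' (n + 1)) = u' n)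
    {N N' : ℕ} (hN : 1 ≤ N) (hN' : 1 ≤ N') {z z' : bmaxZero F p}
    (hz : algebraMap (Ainf (p := p) F) (bmaxZero F p)
        ((AinfTop.of F p).symm (((divisionLiftPt W hθ u hup).val : (nilTheta F p hθ).toIdeal) : AinfTop F p)) ^ N =
      (p : bmaxZero F p) * z)
    (hz' : algebraMap (Ainf (p := p) F) (bmaxZero F p)
        ((AinfTop.of F p).symm (((divisionLiftPt W hθ u' hup').val : (nilTheta F p hθ).toIdeal) : AinfTop F p)) ^ N' =
      (p : bmaxZero F p) * z') :
    let Λ := PadicLogSeries.logSum ((algebraMap (Ainf (p := p) F) (bmaxZero F p)).comp zpToAinf) (GaloisContinuity.formalLogNum W p) N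
      (algebraMap (Ainf (p := p) F) (bmaxZero F p)
        ((AinfTop.of F p).symm (((divisionLiftPt W hθ u hup).val : (nilTheta F p hθ).toIdeal) : AinfTop F p))) z
    let Λ' := PadicLogSeries.logSum ((algebraMap (Ainf (p := p) F) (bmaxZero F p)).comp zpToAinf) (GaloisContinuity.formalLogNum W p) N'
      (algebraMap (Ainf (p := p) F) (bmaxZero F p)
        ((AinfTop.of F p).symm (((divisionLiftPt W hθ u' hup').val : (nilTheta F p hθ).toIdeal) : AinfTop F p))) z'
    frobBmaxPlus F p (Λ * frobBmaxPlus F p Λ' - frobBmaxPlus F p Λ * Λ') =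
      (p : BmaxPlus F p) * (Λ * frobBmaxPlus F p Λ' - frobBmaxPlus F p Λ * Λ') := by
  intro Λ Λ'
  have hR := frobBmaxPlus_honda_logSum_divisionLiftPt_eq_zero W (hθ := hθ) a e he hup hN hz
  have hR' := frobBmaxPlus_honda_logSum_divisionLiftPt_eq_zero W (hθ := hθ) a e he hup' hN' hz'
  have hofp : AdicCompletion.of (Ideal.span {(p : bmaxZero F p)}) (bmaxZero F p) (p : bmaxZero F p) = (p : BmaxPlus F p) :=
    map_natCast (algebraMap (bmaxZero F p) (BmaxPlus F p)) p
  rw [hofp] at hR hR'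
  exact PadicLogSeries.frob_det_eq_mul_det (frobBmaxPlus F p) hR hR'

end AinfTop

end Literature.NumberTheory.PAdicHodge

end
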